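import Literature.NumberTheory.EllipticCurves.AnticyclotomicSignedTransferInputs
import Literature.NumberTheory.EllipticCurves.AnticyclotomicSignedSelmerDualMapsProofs
import Literature.NumberTheory.EllipticCurves.AnticyclotomicSignedSelmerModuleFiniteProofs
import Literature.NumberTheory.EllipticCurves.IwasawaAlgebraSemilinearCharIdealProofs
import HarnessLib

/-!
# Castella–Wan's transfer "signed Heegner-point divisibility ⟹ Greenberg/BDP divisibility"
# (proof of Thm. 6.8, (6.12)–(6.16)) PROVED as prime-free module algebra on the tree's carriers

Topic `Literature/NumberTheory/EllipticCurves`; namespace `Literature.NumberTheory.EllipticCurves.AcSigned`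
(the object namespace of the series `AnticyclotomicSignedSelmer.lean` (discrete carriers `selmer`,
duals `X`), `AnticyclotomicSignedCompactSelmer.lean` (`selmerLambdaAdic`),
`AnticyclotomicSignedLocalConditions.lean` (`localSignedLambdaAdic`), `AnticyclotomicSignedLocalisation.lean`
(`loc`), `AnticyclotomicSignedTransferInputs.lean` (`locSignedAt`, `IsSignedLog`, `TransferInputs`)).
Cell `pub/bsd-wall` of the BSD summit, literature-typer seat `bsd-wall-utd-ty1` (generation 5),
`--supports` stmt-BirchSwinnertonDyer-23594 = crux `TwinSplitIMCAtThreeGoodSSApZero` of the route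
`UniversalToricDescent`, whose `⊇`/Howard half (`stub_howardFrameSS_apZero`) is the PORT to `p = 3` of
Castella–Wan's deduction "Thm. A.5 (Kolyvagin-system bound for `X_±`) ⟹ `L_p^BDP ∈
char_{Λac}(X^{rel,str}) Λ^ur`" (Thm. 6.8, "the same result holds for the opposite divisibilities").
The previous files of the series TYPED the carriers and the inputs of that deduction (the structure
`TransferInputs`: [PR00, §1.3.3], the global-duality sequences (6.12)–(6.13), Lemma 6.7 (2), Def. 6.1
+ Thm. 6.2, Cor. 6.4) and left "the module algebra (6.14)–(6.16)" to the consumer. THIS FILE PROVES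
THAT ALGEBRA, for every prime `p`, every number field `K`, every curve, as THEOREMS (no definition, no
named fact, no `sorry`, standard axioms): given `TransferInputs … ε z L` and the Howard-side input
(`Sel_ε(K, 𝐓^ac)` and `X_ε` of rank one, `ι(char(Sel_ε/Λ z))² ⊆ char(X_{ε,tors})`), the dual
`X^{rel,str}` is finitely generated `Λ`-torsion and `L ∈ char_Λ(X^{rel,str}) · R₀⟦T⟧`; and the bridge
`char_Λ(X^{rel,str}) = Ch_Λ(X_ac(E[p^∞]))` to the tree object `Castella2018.AcSelmer.XAc` in which
the crux is stated. So at `p = 3` the crux's `⊇` half is EXACTLY: the Howard side at `3` + the six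
fields of `TransferInputs` at `3`. NOTHING is established at `p = 3` here (the inputs are
hypotheses); the Birch–Swinnerton-Dyer conjecture is not advanced by this file; typed ≠ proved for the
inputs.

## The printed proof (Castella–Wan, MS pp. 30–31) and its transcription

Print: "`E(K_∞)[p^∞] = 0`, which by [PR00, §1.3.3] implies that the `Λ^ac`-torsion submodule of
`H¹(K, 𝐓^ac)` is trivial [`torsionFree`]. Global duality yields … (6.12) `0 → Sel^{str,rel} →
Sel^{±,rel} —loc_𝔭→ H¹_±(K_𝔭, 𝐓^ac) → X^{rel,str} → X^{±,str} → 0` [`exact612`] … (6.13) `0 →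
Sel^{str,±} → Sel_± —loc_𝔭→ H¹_±(K_𝔭, 𝐓^ac) → X^{rel,±} → X_± → 0` [`exact613`]. Since `H¹(K, 𝐓^ac)`
has trivial `Λ^ac`-torsion, the non-vanishing of `loc_𝔭` [`loc_nonTorsion`] and the equality
`rank(Sel_±) = 1` implies that `Sel^{str,±}(K, 𝐓^ac) = 0` [§2: `loc_𝔭` is injective on `Sel_ε`]. From
(6.13) we thus obtain `0 → Sel_±/Λ z → H¹_±/Λ loc(z) → coker(loc_𝔭) → 0`, which by Theorem 6.2
[`signedLog_erl`, `H¹_± ≃ Λ` by `Log`] yields (6.14) `char(Sel_±/Λz) · char(coker loc_𝔭) Λ^ur =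
(𝓛^BDP_𝔭)` [§3: `char(Sel_ε/Λz) · char(Λ/I) = (Log loc z)`, `I = Log(loc_𝔭(Sel_ε))`]. On the other
hand, taking `Λ^ac`-torsion in `0 → coker(loc_𝔭) → X^{rel,±} → X_± → 0` deduced from (6.13) and using
Lemma 6.7 (2) (noting that `X^{±,str}` is `Λ^ac`-torsion) we obtain (6.15) `char(X^{±,str}) =
char(X^±_tors) · char(coker(loc_𝔭))` [§4; the connecting map is `ι`-semilinear for the tree's dual
convention, so `coker(loc_𝔭)` enters as the twisted cyclic module `Λ/ι(I)`, whose characteristic ideal is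
`ι(char(Λ/I))` by `Module.charIdeal_quotient_map_ringEquiv`]. Similarly `0 → coker(loc_𝔭) → X^{rel,str}
→ X^{±,str} → 0` from (6.12) yields `char(X^{rel,str}) = char(X^{±,str}) · char(coker(loc_𝔭)) =
char(X^±_tors) · char(coker(loc_𝔭))²` [§5] … The equivalence between the divisibilities … is now
clear" [§6: with `char(X_{ε,tors}) ⊇ ι(char(Sel_ε/Λz))²` one gets `char(X^{rel,str}) ⊇ (ι(Log loc z))²`,
and `(L) = ι((Log loc z)²) R₀⟦T⟧` gives `L ∈ char(X^{rel,str}) R₀⟦T⟧`].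
DEVIATIONS (each a weakening of what is used, never a strengthening of what is claimed): (a) print
identifies `Sel_± = Sel^{±,rel}` (via Prop. 3.8) to use one `coker(loc_𝔭)` in (6.12) and (6.13); here
`coker(loc_𝔭 | Sel^{ε,rel})` is only a QUOTIENT of `coker(loc_𝔭 | Sel_ε)` (`Sel_ε ≤ Sel^{ε,rel}`), which
suffices for the `⊇` direction (`Module.charIdeal_quotient_mono`); (b) the Howard-side
divisibility carries the involution `ι` (flag `dual-convention` of the sibling file: with the tree's
precomposition action on duals the statement equivalent to print's is `char(X_{ε,tors}) ⊇
ι(char(Sel_ε/Λz))²`; for the `(ε, ε)` objects it is equivalent to the `ι`-free form by the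
complex-conjugation symmetry, which is NOT proved here); (c) only the direction (i) ⟹ (ii) with `⊇`
(the one the crux consumes) is formalised.

## Contents (all PROVED; no definition, no named fact)

* §1 involution bookkeeping on ideals of `Λ`: `mem_map_invol_iff`, `map_invol_eq_map_involEquiv`,
  `map_invol_span_singleton`, `map_invol_mul`, `charIdeal_quotient_map_invol`
  (`char(Λ ⧸ ι(J)) = ι(char(Λ ⧸ J))`), `isTorsion_quotient_map_invol`.
* §2 `TransferInputs.ne_zero`, `TransferInputs.locSignedAt_injective` ("`Sel^{str,ε} = 0`":
  `loc_𝔭` is injective on `Sel_ε(K, 𝐓^ac)` of rank one).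
* §3 (6.14): `ker_mkQ_comp_eq_span_singleton`, `charIdeal_quotient_span_mul_charIdeal_quotient_range`
  — for an injective `Λ`-linear `ψ : S → Λ` and `z ∈ S` with `ψ z ≠ 0`: `char(S/Λz) · char(Λ/ψ(S)) =
  (ψ z)`.
* §4 the twisted cokernel: `exists_linearMap_range_eq_ker_eq_of_semilinear` — an `ι`-semilinear
  `δ : H → X` with `ker δ = loc(S)` and a `Λ`-linear bijection `Log : H → Λ` give a `Λ`-LINEAR
  `Φ : Λ → X`, `f ↦ δ(Log⁻¹(ι f))`, with `im Φ = im δ` and `ker Φ = ι(Log(loc S))` (so `im δ ≃ₗ Λ ⧸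
  ι(I)` is torsion with characteristic ideal `ι(char(Λ ⧸ I))`).
* §5 the carriers: `X.exists_restrict_linearMap` (the restrictions `X^{𝓛′} ↠ X^{𝓛}` as `Λ`-linear
  surjections), `selmerLambdaAdic_sgn_le_at_rel` (`Sel_ε ≤ Sel^{ε,rel}` on the compact side).
* §6 the assembly: **`TransferInputs.isFGTorsion_and_sq_mem_charIdeal`** (`X^{rel,str}` f.g. torsion,
  `X^{ε,str}` torsion, `rank X^{rel,ε} = 1`, `(ι(Log loc_𝔭 z))² ∈ char_Λ(X^{rel,str})` for every signed
  logarithm) and **`TransferInputs.mem_charIdeal_map_of_howard`** (`L ∈ char_Λ(X^{rel,str}) · R₀⟦T⟧`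
  along every compatible `j`).
* §7 the bridge to `Castella2018.AcSelmer.XAc`: `X.exists_linearEquiv_XAc`,
  `X.charIdeal_at_str_rel_eq_XAc_charIdeal`, `X.isTorsion_XAc_of_at_str_rel`.
* §8 the crux-shaped corollary for a base change `W⁄K`: `TransferInputs.mem_XAc_charIdeal_map_of_howard`.

## References

* [CastellaWan2023] F. Castella, X. Wan, *Perrin-Riou's main conjecture for elliptic curves at
  supersingular primes*, Math. Ann. 389 (2024) 2595–2636; accepted MS `paper:url-7157bd4f7b88`, proof
  of Thm. 6.8 with (6.12)–(6.16), MS pp. 30–31 (read 2026-08-28).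
* [Castella2018] F. Castella, Camb. J. Math. 6 (2018), Def. 2.2 (the object `X_ac^Σ(E[p^∞])`).
* [GreenbergLNM1716] R. Greenberg, LNM 1716 (1999), §1 p. 60 (the `Λ`-action on Pontryagin duals).
* [BourbakiAC5to7] N. Bourbaki, *Algèbre commutative* VII §4.5 (characteristic ideals).
-/

noncomputable section

open scoped Classical

open PowerSeries NumberField IsDedekindDomain Field
open Literature.NumberTheory.EllipticCurves Literature.NumberTheory.GaloisRepresentations
open Literature.NumberTheory.EllipticCurves.IwasawaDual
open Literature.NumberTheory.EllipticCurves.CastellaWan2024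

universe u

namespace Literature.NumberTheory.EllipticCurves.AcSigned

/-! ## §1 The involution on ideals of `Λ` -/

section Invol

variable (p : ℕ) [Fact p.Prime]

/-- `f ∈ ι(J) ↔ ι f ∈ J` for an ideal `J` of `Λ` (`ι` is an involution, so `ι(J) = ι⁻¹(J)`).
[cite: MazurTateTeitelbaum1986Invent, Ch. I §17] -/
theorem mem_map_invol_iff (J : Ideal (IwasawaAlgebra p)) (f : IwasawaAlgebra p) :
    f ∈ J.map (IwasawaAlgebra.invol p) ↔ IwasawaAlgebra.invol p f ∈ J := by
  constructor
  · intro hf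
    have h : J.map (IwasawaAlgebra.invol p) ≤ J.comap (IwasawaAlgebra.invol p) := by
      rw [Ideal.map_le_iff_le_comap]
      intro g hg
      rw [Ideal.mem_comap, Ideal.mem_comap, IwasawaAlgebra.invol_invol]
      exact hg
    exact h hf
  · intro hf
    rw [← IwasawaAlgebra.invol_invol p f]
    exact Ideal.mem_map_of_mem _ hf

/-- `Ideal.map` along the `AlgHom` `ι` is `Ideal.map` along the ring isomorphism `involEquiv`
(same underlying function). [cite: MazurTateTeitelbaum1986Invent, Ch. I §17] -/
theorem map_invol_eq_map_involEquiv (J : Ideal (IwasawaAlgebra p)) :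
    J.map (IwasawaAlgebra.invol p) =
      J.map ((IwasawaAlgebra.involEquiv p).toRingEquiv : IwasawaAlgebra p →+* IwasawaAlgebra p) := by
  rfl

/-- `ι((x)) = (ι x)`. [cite: MazurTateTeitelbaum1986Invent, Ch. I §17] -/
theorem map_invol_span_singleton (x : IwasawaAlgebra p) :
    (Ideal.span {x}).map (IwasawaAlgebra.invol p) = Ideal.span {IwasawaAlgebra.invol p x} := by
  rw [Ideal.map_span, Set.image_singleton]

/-- `ι` is monotone and multiplicative on ideals: `ι(J₁ J₂) = ι(J₁) ι(J₂)`.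
[cite: MazurTateTeitelbaum1986Invent, Ch. I §17] -/
theorem map_invol_mul (J₁ J₂ : Ideal (IwasawaAlgebra p)) :
    (J₁ * J₂).map (IwasawaAlgebra.invol p) = J₁.map (IwasawaAlgebra.invol p) * J₂.map (IwasawaAlgebra.invol p) :=
  Ideal.map_mul _ J₁ J₂

/-- **`char(Λ ⧸ ι(J)) = ι(char(Λ ⧸ J))`** — the twisted cyclic quotient for the Iwasawa involution
(`Module.charIdeal_quotient_map_ringEquiv` for `involEquiv`). [cite: GreenbergLNM1716, §1 p. 60]
[cite: Washington1997, §13.2] -/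
theorem charIdeal_quotient_map_invol (J : Ideal (IwasawaAlgebra p)) :
    Module.charIdeal (IwasawaAlgebra p) (IwasawaAlgebra p ⧸ J.map (IwasawaAlgebra.invol p)) =
      (Module.charIdeal (IwasawaAlgebra p) (IwasawaAlgebra p ⧸ J)).map (IwasawaAlgebra.invol p) := by
  rw [map_invol_eq_map_involEquiv, map_invol_eq_map_involEquiv]
  exact Module.charIdeal_quotient_map_ringEquiv (IwasawaAlgebra.involEquiv p).toRingEquiv J

/-- `Λ ⧸ ι(J)` is torsion when `J` contains a non-zero element (Castella–Wan, proof of Thm. 6.8: the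
cokernels `Λ^ac ⧸ ι(I)`, `Λ^ac ⧸ ι(I')` of (6.12)–(6.13) are `Λ^ac`-torsion since `I ∋ Log(loc z) ≠ 0`).
[cite: CastellaWan2023, proof of Thm. 6.8, (6.12)–(6.13) (MS p. 30)] -/
theorem isTorsion_quotient_map_invol {J : Ideal (IwasawaAlgebra p)} {a : IwasawaAlgebra p}
    (ha : a ≠ 0) (haJ : a ∈ J) :
    Module.IsTorsion (IwasawaAlgebra p) (IwasawaAlgebra p ⧸ J.map (IwasawaAlgebra.invol p)) := by
  refine Module.isTorsion_quotient_of_ne_zero_mem (a := IwasawaAlgebra.invol p a) ?_ ?_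
  · intro h
    exact ha (IwasawaAlgebra.invol_injective p (by rw [h, map_zero]))
  · exact Ideal.mem_map_of_mem _ haJ

end Invol

/-! ## §2 "`Sel^{str,ε}(K, 𝐓^ac) = 0`": `loc_𝔭` is injective on `Sel_ε(K, 𝐓^ac)` -/

section Injective

variable {K : Type u} [Field K] [NumberField K] {W : WeierstrassCurve K} {p : ℕ} [Fact p.Prime]
  {κ : ZpExtension K p} {γ : absoluteGaloisGroup K} {hγ : κ.IsTopGenerator γ}
  {𝔭 : HeightOneSpectrum (𝓞 K)} {h𝔭 : IsNonsplitIn κ 𝔭} {γ𝔭 : absoluteGaloisGroup (𝔭.adicCompletion K)}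
  {hγ𝔭 : κ (resGalOfEmb (closureEmb (K := K) (𝔭.adicCompletion K)) γ𝔭) = κ γ}
  {𝔭' : HeightOneSpectrum (𝓞 K)} {h𝔭𝔭' : 𝔭 ≠ 𝔭'} {h𝔭p : ((p : ℕ) : 𝓞 K) ∈ 𝔭.asIdeal} {ε : ℤˣ}
  {z : selmerLambdaAdic W p κ γ (fun _ ↦ .sgn ε)} {L : UnrSeries p}

/-- From the inputs: the class `z` is non-zero (`loc_𝔭(z)` is not torsion; `Λ` is nontrivial).
[cite: CastellaWan2023, Cor. 6.4 (MS p. 27)] -/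
theorem TransferInputs.ne_zero (h : TransferInputs W p κ γ hγ 𝔭 h𝔭 γ𝔭 hγ𝔭 𝔭' h𝔭𝔭' h𝔭p ε z L) : z ≠ 0 := by
  letI := selmerLambdaAdic.moduleOfGen W p κ γ hγ (fun _ ↦ PCond.sgn ε)
  intro hz
  have h1 := h.smul_eq_zero_imp 1 (by rw [hz, smul_zero])
  exact one_ne_zero h1

/-- **"`Sel^{str,±}(K, 𝐓^ac) = 0`": `loc_𝔭` is INJECTIVE on `Sel_ε(K, 𝐓^ac)`** when `Sel_ε` has
`Λ`-rank one (Howard side) — printed: "Since `H¹(K, 𝐓^ac)` has trivial `Λ^ac`-torsion, the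
non-vanishing of `loc_𝔭` and the equality `rank_{Λac}(Sel_±(K, 𝐓^ac)) = 1` implies that
`Sel^{str,±}(K, 𝐓^ac) = 0`, since it is of `Λ^ac`-rank zero". Proof: for `x` with `loc_𝔭 x = 0`,
rank one gives `a x = b z` with `a ≠ 0` (`Module.exists_smul_eq_smul_of_rank_le_one`), so
`b · loc_𝔭 z = 0`, `b = 0` (`loc_nonTorsion`), `a x = 0`, `x = 0` (`torsionFree`).
[cite: CastellaWan2023, proof of Thm. 6.8 (MS p. 30)] -/
theorem TransferInputs.locSignedAt_injective (h : TransferInputs W p κ γ hγ 𝔭 h𝔭 γ𝔭 hγ𝔭 𝔭' h𝔭𝔭' h𝔭p ε z L)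
    (hrank : selmerLambdaAdic.HasRank W p κ γ hγ (fun _ ↦ .sgn ε) 1) :
    Function.Injective (locSignedAt W p κ 𝔭 h𝔭 γ γ𝔭 hγ𝔭 (fun _ ↦ .sgn ε) ε rfl h𝔭p) := by
  letI := selmerLambdaAdic.moduleOfGen W p κ γ hγ (fun _ ↦ PCond.sgn ε)
  letI := localSignedLambdaAdic.moduleOfGen (W.baseChange (𝔭.adicCompletion K)) p (localizeAt κ 𝔭 h𝔭)
    γ𝔭 (isTopGenerator_localize_of_apply_eq p κ _ h𝔭 hγ𝔭 hγ) ε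
  haveI : Module.IsTorsionFree (IwasawaAlgebra p) (selmerLambdaAdic W p κ γ (fun _ ↦ .sgn ε)) :=
    Module.IsTorsionFree.of_smul_eq_zero (h.torsionFree (fun _ ↦ .sgn ε))
  haveI : Module.Finite (IwasawaAlgebra p) (selmerLambdaAdic W p κ γ (fun _ ↦ .sgn ε)) := hrank.1
  have hrk : Module.rank (IwasawaAlgebra p) (selmerLambdaAdic W p κ γ (fun _ ↦ .sgn ε)) ≤ 1 := by
    rw [← Module.finrank_eq_rank, hrank.2, Nat.cast_one]
  rw [injective_iff_map_eq_zero]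
  intro x hx
  obtain ⟨a, b, ha, hab⟩ := Module.exists_smul_eq_smul_of_rank_le_one hrk h.ne_zero x
  have hb : b = 0 := by
    refine h.loc_nonTorsion b ?_
    rw [← locSignedAt_smul W p κ 𝔭 h𝔭 hγ𝔭 hγ rfl h𝔭p b z, ← hab,
      locSignedAt_smul W p κ 𝔭 h𝔭 hγ𝔭 hγ rfl h𝔭p a x, hx, smul_zero]
  rw [hb, zero_smul] at hab
  exact ((h.torsionFree (fun _ ↦ .sgn ε) a x hab).resolve_left ha)

end Injective

/-! ## §3 (6.14): `char(S ⧸ Λz) · char(Λ ⧸ ψ(S)) = (ψ z)` for an injective `Λ`-linear `ψ : S → Λ` -/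

section SixFourteen

variable {p : ℕ} [Fact p.Prime] {S : Type*} [AddCommGroup S] [Module (IwasawaAlgebra p) S]

/-- The kernel of `S —ψ→ Λ ↠ Λ ⧸ (ψ z)` is `Λ z` when `ψ` is injective (the first map of the exact
sequence `0 → Sel_ε ⧸ Λ z → Λ ⧸ (Log loc z) → Λ ⧸ I → 0` behind (6.14)).
[cite: CastellaWan2023, proof of Thm. 6.8, (6.14) (MS p. 31)] -/
theorem ker_mkQ_comp_eq_span_singleton (ψ : S →ₗ[IwasawaAlgebra p] IwasawaAlgebra p)
    (hψ : Function.Injective ψ) (z : S) :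
    LinearMap.ker ((Ideal.span {ψ z}).mkQ ∘ₗ ψ) = Submodule.span (IwasawaAlgebra p) {z} := by
  ext x
  rw [LinearMap.mem_ker, LinearMap.comp_apply, Submodule.mkQ_apply, Submodule.Quotient.mk_eq_zero,
    Ideal.mem_span_singleton', Submodule.mem_span_singleton]
  constructor
  · rintro ⟨c, hc⟩
    refine ⟨c, hψ ?_⟩
    rw [map_smul, smul_eq_mul, hc]
  · rintro ⟨c, rfl⟩
    exact ⟨c, by rw [map_smul, smul_eq_mul]⟩

/-- **(6.14) in tree form.** For an injective `Λ`-linear map `ψ : S → Λ` (in the application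
`ψ = Log ∘ loc_𝔭 : Sel_ε(K, 𝐓^ac) → H¹_ε(K_𝔭, 𝐓^ac) ≃ Λ`) and `z ∈ S` with `ψ z ≠ 0`:
`char(S ⧸ Λ z) · char(Λ ⧸ ψ(S)) = (ψ z)` — from the short exact sequence
`0 → S/Λz ≅ ψ(S)/(ψ z) → Λ/(ψ z) → Λ/ψ(S) → 0` and `char(Λ/(a)) = (a)`
(`Module.charIdeal_quotient_span_singleton`). Printed: "`0 → Sel_±/Λ^ac z^±_∞ —loc_𝔭→ H¹_±(K_𝔭,
𝐓^ac)/Λ^ac loc(z^±_∞) → coker(loc_𝔭) → 0`, which by Theorem 6.2 yields the relation (6.14)".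
[cite: CastellaWan2023, proof of Thm. 6.8, (6.14) (MS pp. 30–31)] [cite: Washington1997, §13.2] -/
theorem charIdeal_quotient_span_mul_charIdeal_quotient_range
    (ψ : S →ₗ[IwasawaAlgebra p] IwasawaAlgebra p) (hψ : Function.Injective ψ) (z : S) (hz : ψ z ≠ 0) :
    Module.charIdeal (IwasawaAlgebra p) (S ⧸ Submodule.span (IwasawaAlgebra p) {z}) *
      Module.charIdeal (IwasawaAlgebra p) (IwasawaAlgebra p ⧸ LinearMap.range ψ) =
      Ideal.span {ψ z} := by
  set A : Ideal (IwasawaAlgebra p) := Ideal.span {ψ z} with hA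
  have hAI : A ≤ LinearMap.range ψ := by
    rw [hA, Ideal.span_singleton_le_iff_mem]
    exact ⟨z, rfl⟩
  have hAtors : Module.IsTorsion (IwasawaAlgebra p) (IwasawaAlgebra p ⧸ A) :=
    Module.isTorsion_quotient_of_ne_zero_mem hz (Ideal.mem_span_singleton_self _)
  -- `S ⧸ Λz ≃ₗ A.mkQ(range ψ)`
  let φ : S →ₗ[IwasawaAlgebra p] IwasawaAlgebra p ⧸ A := A.mkQ ∘ₗ ψ
  have hker : LinearMap.ker φ = Submodule.span (IwasawaAlgebra p) {z} :=
    ker_mkQ_comp_eq_span_singleton ψ hψ z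
  have hrange : LinearMap.range φ = (LinearMap.range ψ).map A.mkQ := LinearMap.range_comp _ _
  have e : (S ⧸ Submodule.span (IwasawaAlgebra p) {z}) ≃ₗ[IwasawaAlgebra p]
      (LinearMap.range ψ).map A.mkQ :=
    (Submodule.quotEquivOfEq _ _ hker.symm).trans (φ.quotKerEquivRange.trans (LinearEquiv.ofEq _ _ hrange))
  rw [Module.charIdeal_eq_of_linearEquiv e,
    Module.charIdeal_quotient_mul_charIdeal_quotient_map A (LinearMap.range ψ) hAI hAtors, hA,
    Module.charIdeal_quotient_span_singleton hz]

end SixFourteen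

/-! ## §4 The twisted cokernel: an `ι`-semilinear connecting map with kernel `loc(S)` makes its image
`≃ₗ Λ ⧸ ι(Log(loc S))` -/

section Twisted

variable {p : ℕ} [Fact p.Prime] {S : Type*} {H : Type*} [AddCommGroup H] [Module (IwasawaAlgebra p) H]
  {X : Type*} [AddCommGroup X] [Module (IwasawaAlgebra p) X]

/-- **The twisted cokernel.** Let `loc : S → H` be any map, `Log : H → Λ` additive, `Λ`-linear and
bijective (a signed logarithm), and `δ : H → X` additive, `ι`-SEMILINEAR (`δ(f·y) = ι(f)·δ(y)`) with
`ker δ = loc(S)` (exactness of (6.12)/(6.13) at `H¹_ε(K_𝔭, 𝐓^ac)`); let `I ⊆ Λ` be the ideal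
`Log(loc(S))`. Then `Φ(f) := δ(Log⁻¹(ι f))` is a `Λ`-LINEAR map `Λ → X` with the same image as `δ` and
kernel `ι(I)`; consequently `im δ ≃ₗ Λ ⧸ ι(I)`. (Greenberg's remark that the two `Λ`-structures on a
Pontryagin dual differ by `ι`, applied to Castella–Wan's `coker(loc_𝔭) ↪ X^{rel,·}`.)
[cite: GreenbergLNM1716, §1 p. 60] [cite: CastellaWan2023, proof of Thm. 6.8, (6.12)–(6.13) (MS p. 30)] -/
theorem exists_linearMap_range_eq_ker_eq_of_semilinear
    (loc : S → H) (Log : H →+ IwasawaAlgebra p)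
    (hLoglin : ∀ (f : IwasawaAlgebra p) (y : H), Log (f • y) = f * Log y)
    (hLogbij : Function.Bijective Log) (δ : H →+ X)
    (hδ : ∀ (f : IwasawaAlgebra p) (y : H), δ (f • y) = IwasawaAlgebra.invol p f • δ y)
    (hker : ∀ y : H, δ y = 0 ↔ ∃ x : S, loc x = y)
    (I : Ideal (IwasawaAlgebra p)) (hI : ∀ f, f ∈ I ↔ ∃ x : S, Log (loc x) = f) :
    ∃ Φ : IwasawaAlgebra p →ₗ[IwasawaAlgebra p] X,
      (∀ x' : X, (∃ f, Φ f = x') ↔ ∃ y, δ y = x') ∧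
      LinearMap.ker Φ = I.map (IwasawaAlgebra.invol p) := by
  let Logₗ : H →ₗ[IwasawaAlgebra p] IwasawaAlgebra p :=
    { toFun := Log, map_add' := map_add Log, map_smul' := fun f y ↦ hLoglin f y }
  let eLog : H ≃ₗ[IwasawaAlgebra p] IwasawaAlgebra p := LinearEquiv.ofBijective Logₗ hLogbij
  have heLog : ∀ y, eLog y = Log y := fun _ ↦ rfl
  let Φ : IwasawaAlgebra p →ₗ[IwasawaAlgebra p] X :=
    { toFun := fun f ↦ δ (eLog.symm (IwasawaAlgebra.invol p f))
      map_add' := fun f g ↦ by rw [map_add, map_add, map_add]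
      map_smul' := fun g f ↦ by
        rw [RingHom.id_apply, smul_eq_mul, map_mul, ← smul_eq_mul, map_smul, hδ,
          IwasawaAlgebra.invol_invol] }
  have hΦ : ∀ f, Φ f = δ (eLog.symm (IwasawaAlgebra.invol p f)) := fun _ ↦ rfl
  refine ⟨Φ, fun x' ↦ ⟨?_, ?_⟩, ?_⟩
  · rintro ⟨f, rfl⟩
    exact ⟨_, (hΦ f).symm⟩
  · rintro ⟨y, rfl⟩
    refine ⟨IwasawaAlgebra.invol p (eLog y), ?_⟩
    rw [hΦ, IwasawaAlgebra.invol_invol, LinearEquiv.symm_apply_apply]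
  · ext f
    rw [LinearMap.mem_ker, hΦ, hker, mem_map_invol_iff, hI]
    constructor
    · rintro ⟨x, hx⟩
      refine ⟨x, ?_⟩
      rw [hx, ← heLog, LinearEquiv.apply_symm_apply]
    · rintro ⟨x, hx⟩
      refine ⟨x, ?_⟩
      rw [← heLog] at hx
      rw [← hx, LinearEquiv.symm_apply_apply]

end Twisted

/-! ## §5 The carriers: the restriction maps of (6.12)/(6.13) on the duals as `Λ`-linear surjections,
and the compact maps `Log ∘ loc_𝔭` -/

section Carriers

variable {K : Type u} [Field K] [NumberField K] (W : WeierstrassCurve K) (p : ℕ) [Fact p.Prime]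
  (κ : ZpExtension K p) {γ : absoluteGaloisGroup K} (hγ : κ.IsTopGenerator γ)

/-- **The restriction `X^{𝓛′} ↠ X^{𝓛}` as a `Λ`-LINEAR SURJECTION** for `Sel^{𝓛} ≤ Sel^{𝓛′}` (the
sibling file's `X.smulFun_comp_inclusion` / `X.comp_inclusion_surjective`, packaged): there is a
`Λ`-linear `r : X^{𝓛′} → X^{𝓛}` with `r x = x ∘ incl`, surjective. E.g. `X^{rel,±} ↠ X_±`,
`X^{rel,str} ↠ X^{±,str}` of Castella–Wan (6.13)/(6.12). [cite: CastellaWan2023, (6.12)–(6.13) (MS p. 30)]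
[cite: GreenbergLNM1716, §1 p. 60] -/
theorem X.exists_restrict_linearMap {S₀ : Set (HeightOneSpectrum (𝓞 K))}
    {L₁ L₂ : HeightOneSpectrum (𝓞 K) → PCond} (hle : selmer W p κ S₀ L₁ ≤ selmer W p κ S₀ L₂) :
    letI := X.moduleOfGen W p κ S₀ L₁ hγ
    letI := X.moduleOfGen W p κ S₀ L₂ hγ
    ∃ r : X W p κ S₀ L₂ →ₗ[IwasawaAlgebra p] X W p κ S₀ L₁,
      (∀ x, r x = x.comp (AddSubgroup.inclusion hle)) ∧ Function.Surjective r := by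
  letI i₁ : Module (IwasawaAlgebra p) (X W p κ S₀ L₁) := X.moduleOfGen W p κ S₀ L₁ hγ
  letI i₂ : Module (IwasawaAlgebra p) (X W p κ S₀ L₂) := X.moduleOfGen W p κ S₀ L₂ hγ
  let r : X W p κ S₀ L₂ →ₗ[IwasawaAlgebra p] X W p κ S₀ L₁ :=
    { toFun := fun x ↦ x.comp (AddSubgroup.inclusion hle)
      map_add' := fun x y ↦ by ext s; rfl
      map_smul' := fun f x ↦ by
        change ((isLocNil_conjSelmer_sub_one W p κ S₀ L₂ hγ).smulFun f x).comp
            (AddSubgroup.inclusion hle) =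
          (isLocNil_conjSelmer_sub_one W p κ S₀ L₁ hγ).smulFun f (x.comp (AddSubgroup.inclusion hle))
        exact (X.smulFun_comp_inclusion W p κ hle hγ f x).symm }
  exact ⟨r, fun _ ↦ rfl, X.comp_inclusion_surjective W p κ hle⟩

/-- `Sel_ε ≤ Sel^{ε, rel at 𝔮}` on the compact side (relaxing the condition at one prime `𝔮`).
[cite: CastellaWan2023, Lemma 4.7 and (6.12) (MS pp. 22, 30)] -/
theorem selmerLambdaAdic_sgn_le_at_rel (γ₀ : absoluteGaloisGroup K) (𝔮 : HeightOneSpectrum (𝓞 K))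
    (ε : ℤˣ) :
    selmerLambdaAdic W p κ γ₀ (fun _ ↦ .sgn ε) ≤ selmerLambdaAdic W p κ γ₀ (PCond.at 𝔮 .rel (.sgn ε)) :=
  selmerLambdaAdic_le_of_rel fun v _ ↦ by
    by_cases hv : v = 𝔮
    · rw [hv]; exact Or.inr (PCond.at_self _ _ _)
    · exact Or.inl (PCond.at_of_ne _ _ hv)

end Carriers

/-! ## §6 The assembly (6.14)–(6.16): `TransferInputs` + Howard side ⟹ `X^{rel,str}` torsion and
`L ∈ char_Λ(X^{rel,str}) · R₀⟦T⟧` -/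

section Assembly

variable {K : Type u} [Field K] [NumberField K] {W : WeierstrassCurve K} {p : ℕ} [Fact p.Prime]
  {κ : ZpExtension K p} {γ : absoluteGaloisGroup K} {hγ : κ.IsTopGenerator γ}
  {𝔭 : HeightOneSpectrum (𝓞 K)} {h𝔭 : IsNonsplitIn κ 𝔭} {γ𝔭 : absoluteGaloisGroup (𝔭.adicCompletion K)}
  {hγ𝔭 : κ (resGalOfEmb (closureEmb (K := K) (𝔭.adicCompletion K)) γ𝔭) = κ γ}
  {𝔭' : HeightOneSpectrum (𝓞 K)} {h𝔭𝔭' : 𝔭 ≠ 𝔭'} {h𝔭p : ((p : ℕ) : 𝓞 K) ∈ 𝔭.asIdeal} {ε : ℤˣ}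
  {z : selmerLambdaAdic W p κ γ (fun _ ↦ .sgn ε)} {L : UnrSeries p}

set_option maxHeartbeats 4000000 in
set_option synthInstance.maxHeartbeats 200000 in
/-- **The transfer, main statement (Castella–Wan, proof of Thm. 6.8, (i) ⟹ (ii) with `⊇`), PROVED
on the tree's carriers for every prime `p`.** Hypotheses: `TransferInputs … ε z L` (the six typed
inputs) and the HOWARD SIDE — `Sel_ε(K, 𝐓^ac)` finitely generated of rank one
(`selmerLambdaAdic.HasRank … 1`), `X_ε` of rank one (`X.HasRank … 1`), and the divisibility
`ι(char_Λ(Sel_ε(K, 𝐓^ac)/Λ z))² ⊆ char_Λ(X_{ε,tors})` (flag `dual-convention`: the `ι`-twisted form of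
print's "`char(X^±_tors) ⊃ char(Sel_±(K, 𝐓^ac)/Λ^ac z^±_∞)²`", Thm. A.5); `E` elliptic (finite
generation of the duals, `X.module_finite_empty`). Conclusions: (1) `X^{rel,str}` (`X … ∅ (PCond.at 𝔭'
.str .rel)`) is finitely generated `Λ`-torsion; (2) `(ι(Log(loc_𝔭 z)))² ∈ char_Λ(X^{rel,str})` for
every signed logarithm, hence (3) along every structure map `j : ℤ_p → R₀` compatible with `ℤ_p ⊂ ℂ_p`,
`L ∈ char_Λ(X^{rel,str}) · R₀⟦T⟧`; moreover `rank X^{rel,ε} = 1` and `X^{ε,str}` is torsion. This is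
clauses (ii) of Thm. 6.8 with `⊇` (except "`Sel^{str,rel}(K, 𝐓^ac)` torsion", which needs Prop. 3.8),
derived as printed ((6.12)–(6.16)) with the deviations recorded in the module docstring.
[cite: CastellaWan2023, Thm. 6.8 and its proof, (6.12)–(6.16) (MS pp. 29–31)] -/
theorem TransferInputs.isFGTorsion_and_sq_mem_charIdeal [W.IsElliptic]
    (h : TransferInputs W p κ γ hγ 𝔭 h𝔭 γ𝔭 hγ𝔭 𝔭' h𝔭𝔭' h𝔭p ε z L)
    (hS : selmerLambdaAdic.HasRank W p κ γ hγ (fun _ ↦ .sgn ε) 1)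
    (hX : X.HasRank W p κ ∅ (fun _ ↦ .sgn ε) hγ 1)
    (hHoward :
      letI := selmerLambdaAdic.moduleOfGen W p κ γ hγ (fun _ ↦ PCond.sgn ε)
      ((Module.charIdeal (IwasawaAlgebra p)
          (selmerLambdaAdic W p κ γ (fun _ ↦ .sgn ε) ⧸
            Submodule.span (IwasawaAlgebra p) {z})).map (IwasawaAlgebra.invol p)) ^ 2 ≤
        X.torsionCharIdeal W p κ ∅ (fun _ ↦ .sgn ε) hγ) :
    X.IsFGTorsion W p κ ∅ (PCond.at 𝔭' .str .rel) hγ ∧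
    (letI := X.moduleOfGen W p κ ∅ (PCond.at 𝔭' .str (.sgn ε)) hγ
     Module.IsTorsion (IwasawaAlgebra p) (X W p κ ∅ (PCond.at 𝔭' .str (.sgn ε)))) ∧
    X.HasRank W p κ ∅ (PCond.at 𝔭 .rel (.sgn ε)) hγ 1 ∧
    ∀ (Log : localSignedLambdaAdic (W.baseChange (𝔭.adicCompletion K)) p (localizeAt κ 𝔭 h𝔭) γ𝔭 ε →+
        IwasawaAlgebra p), IsSignedLog W p κ γ hγ 𝔭 h𝔭 γ𝔭 hγ𝔭 ε Log →
      IwasawaAlgebra.invol p (Log (locSignedAt W p κ 𝔭 h𝔭 γ γ𝔭 hγ𝔭 (fun _ ↦ .sgn ε) ε rfl h𝔭p z)) ^ 2 ∈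
        X.charIdeal W p κ ∅ (PCond.at 𝔭' .str .rel) hγ := by
  -- the carriers and their module structures
  letI iS : Module (IwasawaAlgebra p) (selmerLambdaAdic W p κ γ (fun _ ↦ .sgn ε)) :=
    selmerLambdaAdic.moduleOfGen W p κ γ hγ (fun _ ↦ PCond.sgn ε)
  letI iS' : Module (IwasawaAlgebra p) (selmerLambdaAdic W p κ γ (PCond.at 𝔭' .rel (.sgn ε))) :=
    selmerLambdaAdic.moduleOfGen W p κ γ hγ (PCond.at 𝔭' .rel (.sgn ε))
  letI iH : Module (IwasawaAlgebra p) (localSignedLambdaAdic (W.baseChange (𝔭.adicCompletion K)) p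
      (localizeAt κ 𝔭 h𝔭) γ𝔭 ε) :=
    localSignedLambdaAdic.moduleOfGen (W.baseChange (𝔭.adicCompletion K)) p (localizeAt κ 𝔭 h𝔭)
      γ𝔭 (isTopGenerator_localize_of_apply_eq p κ _ h𝔭 hγ𝔭 hγ) ε
  letI iXre : Module (IwasawaAlgebra p) (X W p κ ∅ (PCond.at 𝔭 .rel (.sgn ε))) :=
    X.moduleOfGen W p κ ∅ (PCond.at 𝔭 .rel (.sgn ε)) hγ
  letI iXe : Module (IwasawaAlgebra p) (X W p κ ∅ (fun _ ↦ .sgn ε)) :=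
    X.moduleOfGen W p κ ∅ (fun _ ↦ .sgn ε) hγ
  letI iXrs : Module (IwasawaAlgebra p) (X W p κ ∅ (PCond.at 𝔭' .str .rel)) :=
    X.moduleOfGen W p κ ∅ (PCond.at 𝔭' .str .rel) hγ
  letI iXes : Module (IwasawaAlgebra p) (X W p κ ∅ (PCond.at 𝔭' .str (.sgn ε))) :=
    X.moduleOfGen W p κ ∅ (PCond.at 𝔭' .str (.sgn ε)) hγ
  haveI : Module.Finite (IwasawaAlgebra p) (X W p κ ∅ (PCond.at 𝔭 .rel (.sgn ε))) :=
    X.module_finite_empty W p κ _ hγ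
  haveI : Module.Finite (IwasawaAlgebra p) (X W p κ ∅ (fun _ ↦ .sgn ε)) :=
    X.module_finite_empty W p κ _ hγ
  haveI : Module.Finite (IwasawaAlgebra p) (X W p κ ∅ (PCond.at 𝔭' .str .rel)) :=
    X.module_finite_empty W p κ _ hγ
  haveI : Module.Finite (IwasawaAlgebra p) (X W p κ ∅ (PCond.at 𝔭' .str (.sgn ε))) :=
    X.module_finite_empty W p κ _ hγ
  -- `Sel_ε ≤ Sel^{ε,rel}` and the two localisation maps agree on it
  have hle : selmerLambdaAdic W p κ γ (fun _ ↦ .sgn ε) ≤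
      selmerLambdaAdic W p κ γ (PCond.at 𝔭' .rel (.sgn ε)) :=
    selmerLambdaAdic_sgn_le_at_rel W p κ γ 𝔭' ε
  have hloc'_incl : ∀ x : selmerLambdaAdic W p κ γ (fun _ ↦ .sgn ε),
      locSignedAt W p κ 𝔭 h𝔭 γ γ𝔭 hγ𝔭 (PCond.at 𝔭' .rel (.sgn ε)) ε (PCond.at_of_ne .rel (.sgn ε) h𝔭𝔭') h𝔭p
          (AddSubgroup.inclusion hle x) =
        locSignedAt W p κ 𝔭 h𝔭 γ γ𝔭 hγ𝔭 (fun _ ↦ .sgn ε) ε rfl h𝔭p x := fun x ↦ Subtype.ext rfl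
  -- everything is proved for an arbitrary signed logarithm `Log`; then a `Log` exists by `signedLog_erl`
  have main : ∀ (Log : localSignedLambdaAdic (W.baseChange (𝔭.adicCompletion K)) p (localizeAt κ 𝔭 h𝔭)
        γ𝔭 ε →+ IwasawaAlgebra p), IsSignedLog W p κ γ hγ 𝔭 h𝔭 γ𝔭 hγ𝔭 ε Log →
      X.IsFGTorsion W p κ ∅ (PCond.at 𝔭' .str .rel) hγ ∧
      Module.IsTorsion (IwasawaAlgebra p) (X W p κ ∅ (PCond.at 𝔭' .str (.sgn ε))) ∧
      X.HasRank W p κ ∅ (PCond.at 𝔭 .rel (.sgn ε)) hγ 1 ∧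
      IwasawaAlgebra.invol p (Log (locSignedAt W p κ 𝔭 h𝔭 γ γ𝔭 hγ𝔭 (fun _ ↦ .sgn ε) ε rfl h𝔭p z)) ^ 2 ∈
        X.charIdeal W p κ ∅ (PCond.at 𝔭' .str .rel) hγ := by
    intro Log hLog
    -- `Λ`-linear packaging of `loc_𝔭` (on `Sel_ε`, `Sel^{ε,rel}`) and of `Log`
    have hloc_smul : ∀ (f : IwasawaAlgebra p) (x : selmerLambdaAdic W p κ γ (fun _ ↦ .sgn ε)),
        locSignedAt W p κ 𝔭 h𝔭 γ γ𝔭 hγ𝔭 (fun _ ↦ .sgn ε) ε rfl h𝔭p (f • x) =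
          f • locSignedAt W p κ 𝔭 h𝔭 γ γ𝔭 hγ𝔭 (fun _ ↦ .sgn ε) ε rfl h𝔭p x :=
      fun f x ↦ locSignedAt_smul W p κ 𝔭 h𝔭 hγ𝔭 hγ rfl h𝔭p f x
    have hloc'_smul : ∀ (f : IwasawaAlgebra p)
        (x : selmerLambdaAdic W p κ γ (PCond.at 𝔭' .rel (.sgn ε))),
        locSignedAt W p κ 𝔭 h𝔭 γ γ𝔭 hγ𝔭 (PCond.at 𝔭' .rel (.sgn ε)) ε
            (PCond.at_of_ne .rel (.sgn ε) h𝔭𝔭') h𝔭p (f • x) =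
          f • locSignedAt W p κ 𝔭 h𝔭 γ γ𝔭 hγ𝔭 (PCond.at 𝔭' .rel (.sgn ε)) ε
            (PCond.at_of_ne .rel (.sgn ε) h𝔭𝔭') h𝔭p x :=
      fun f x ↦ locSignedAt_smul W p κ 𝔭 h𝔭 hγ𝔭 hγ (PCond.at_of_ne .rel (.sgn ε) h𝔭𝔭') h𝔭p f x
    obtain ⟨Logₗ, hLogₗ⟩ : ∃ Logₗ : localSignedLambdaAdic (W.baseChange (𝔭.adicCompletion K)) p
        (localizeAt κ 𝔭 h𝔭) γ𝔭 ε →ₗ[IwasawaAlgebra p] IwasawaAlgebra p, ∀ y, Logₗ y = Log y :=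
      ⟨{ toFun := Log, map_add' := map_add Log, map_smul' := fun f y ↦ hLog.1 f y }, fun _ ↦ rfl⟩
    obtain ⟨locₗ, hlocₗ⟩ : ∃ locₗ : selmerLambdaAdic W p κ γ (fun _ ↦ .sgn ε) →ₗ[IwasawaAlgebra p]
        localSignedLambdaAdic (W.baseChange (𝔭.adicCompletion K)) p (localizeAt κ 𝔭 h𝔭) γ𝔭 ε,
        ∀ x, locₗ x = locSignedAt W p κ 𝔭 h𝔭 γ γ𝔭 hγ𝔭 (fun _ ↦ .sgn ε) ε rfl h𝔭p x :=
      ⟨{ toFun := fun x ↦ locSignedAt W p κ 𝔭 h𝔭 γ γ𝔭 hγ𝔭 (fun _ ↦ .sgn ε) ε rfl h𝔭p x,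
         map_add' := map_add _, map_smul' := fun f x ↦ hloc_smul f x }, fun _ ↦ rfl⟩
    obtain ⟨loc'ₗ, hloc'ₗ⟩ : ∃ loc'ₗ : selmerLambdaAdic W p κ γ (PCond.at 𝔭' .rel (.sgn ε))
        →ₗ[IwasawaAlgebra p]
        localSignedLambdaAdic (W.baseChange (𝔭.adicCompletion K)) p (localizeAt κ 𝔭 h𝔭) γ𝔭 ε,
        ∀ x, loc'ₗ x = locSignedAt W p κ 𝔭 h𝔭 γ γ𝔭 hγ𝔭 (PCond.at 𝔭' .rel (.sgn ε)) ε
          (PCond.at_of_ne .rel (.sgn ε) h𝔭𝔭') h𝔭p x :=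
      ⟨{ toFun := fun x ↦ locSignedAt W p κ 𝔭 h𝔭 γ γ𝔭 hγ𝔭 (PCond.at 𝔭' .rel (.sgn ε)) ε
            (PCond.at_of_ne .rel (.sgn ε) h𝔭𝔭') h𝔭p x,
         map_add' := map_add _, map_smul' := fun f x ↦ hloc'_smul f x }, fun _ ↦ rfl⟩
    -- `ψ = Log ∘ loc_𝔭 : Sel_ε → Λ` and `ψ' = Log ∘ loc_𝔭 : Sel^{ε,rel} → Λ`
    obtain ⟨ψ, hψ⟩ : ∃ ψ : selmerLambdaAdic W p κ γ (fun _ ↦ .sgn ε) →ₗ[IwasawaAlgebra p]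
        IwasawaAlgebra p, ∀ x, ψ x = Log (locSignedAt W p κ 𝔭 h𝔭 γ γ𝔭 hγ𝔭 (fun _ ↦ .sgn ε) ε rfl h𝔭p x) :=
      ⟨Logₗ ∘ₗ locₗ, fun x ↦ by rw [LinearMap.comp_apply, hlocₗ, hLogₗ]⟩
    obtain ⟨ψ', hψ'⟩ : ∃ ψ' : selmerLambdaAdic W p κ γ (PCond.at 𝔭' .rel (.sgn ε)) →ₗ[IwasawaAlgebra p]
        IwasawaAlgebra p, ∀ x, ψ' x = Log (locSignedAt W p κ 𝔭 h𝔭 γ γ𝔭 hγ𝔭 (PCond.at 𝔭' .rel (.sgn ε)) ε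
          (PCond.at_of_ne .rel (.sgn ε) h𝔭𝔭') h𝔭p x) :=
      ⟨Logₗ ∘ₗ loc'ₗ, fun x ↦ by rw [LinearMap.comp_apply, hloc'ₗ, hLogₗ]⟩
    have hψ_inj : Function.Injective ψ := by
      intro x y hxy
      rw [hψ, hψ] at hxy
      exact h.locSignedAt_injective hS (hLog.2.1 hxy)
    have ha : ψ z ≠ 0 := by
      intro ha0
      rw [hψ] at ha0
      have h0 : locSignedAt W p κ 𝔭 h𝔭 γ γ𝔭 hγ𝔭 (fun _ ↦ .sgn ε) ε rfl h𝔭p z = 0 :=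
        hLog.2.1 (by rw [map_zero]; exact ha0)
      exact h.ne_zero (h.locSignedAt_injective hS (by rw [map_zero]; exact h0))
    have hιa : IwasawaAlgebra.invol p (ψ z) ≠ 0 := fun h0 ↦
      ha (IwasawaAlgebra.invol_injective p (by rw [h0, map_zero]))
    -- the ideals `I = Log(loc(Sel_ε)) ⊆ I' = Log(loc(Sel^{ε,rel}))`
    have haI : ψ z ∈ LinearMap.range ψ := ⟨z, rfl⟩
    have hII' : LinearMap.range ψ ≤ LinearMap.range ψ' := by
      rintro _ ⟨x, rfl⟩
      exact ⟨AddSubgroup.inclusion hle x, by rw [hψ', hψ, hloc'_incl]⟩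
    have haI' : ψ z ∈ LinearMap.range ψ' := hII' haI
    -- §3, (6.14): `char(Sel_ε/Λz) · char(Λ/I) = (a)`, `a = ψ z = Log(loc z)`
    have h614 : Module.charIdeal (IwasawaAlgebra p)
          (selmerLambdaAdic W p κ γ (fun _ ↦ .sgn ε) ⧸ Submodule.span (IwasawaAlgebra p) {z}) *
        Module.charIdeal (IwasawaAlgebra p) (IwasawaAlgebra p ⧸ LinearMap.range ψ) =
          Ideal.span {ψ z} :=
      charIdeal_quotient_span_mul_charIdeal_quotient_range ψ hψ_inj z ha
    -- §4: the twisted cokernels as quotients of `Λ`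
    obtain ⟨δ', hδ'lin, hδ'ker, hδ'im⟩ := h.exact613
    obtain ⟨δ, hδlin, hδker, hδim⟩ := h.exact612
    obtain ⟨Φ', hΦ'im, hΦ'ker⟩ := exists_linearMap_range_eq_ker_eq_of_semilinear
      (fun x ↦ locSignedAt W p κ 𝔭 h𝔭 γ γ𝔭 hγ𝔭 (fun _ ↦ .sgn ε) ε rfl h𝔭p x) Log hLog.1 hLog.2 δ'
      hδ'lin hδ'ker (LinearMap.range ψ) (fun f ↦ by
        rw [LinearMap.mem_range]
        exact exists_congr fun x ↦ by rw [hψ])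
    obtain ⟨Φ, hΦim, hΦker⟩ := exists_linearMap_range_eq_ker_eq_of_semilinear
      (fun x ↦ locSignedAt W p κ 𝔭 h𝔭 γ γ𝔭 hγ𝔭 (PCond.at 𝔭' .rel (.sgn ε)) ε
        (PCond.at_of_ne .rel (.sgn ε) h𝔭𝔭') h𝔭p x) Log hLog.1 hLog.2 δ
      hδlin hδker (LinearMap.range ψ') (fun f ↦ by
        rw [LinearMap.mem_range]
        exact exists_congr fun x ↦ by rw [hψ'])
    -- the restriction maps `r' : X^{rel,ε} ↠ X_ε`, `r : X^{rel,str} ↠ X^{ε,str}` and their kernels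
    obtain ⟨r', hr'_apply, hr'_surj⟩ := X.exists_restrict_linearMap W p κ hγ
      (selmer_sgn_le_at_rel W p κ ∅ 𝔭 ε)
    obtain ⟨r, hr_apply, hr_surj⟩ := X.exists_restrict_linearMap W p κ hγ
      (selmer_at_le_rel_away W p κ ∅ (𝔮 := 𝔭') .str (.sgn ε))
    have hker_r' : LinearMap.ker r' = LinearMap.range Φ' := by
      ext x'
      rw [LinearMap.mem_ker, hr'_apply, ← hδ'im x', LinearMap.mem_range]
      exact (hΦ'im x').symm
    have hker_r : LinearMap.ker r = LinearMap.range Φ := by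
      ext x'
      rw [LinearMap.mem_ker, hr_apply, ← hδim x', LinearMap.mem_range]
      exact (hΦim x').symm
    -- both kernels are killed by `ι(a) ≠ 0` (`ι a ∈ ι(I) = ker Φ' ⊆ ker Φ`)
    have hY'tors : ∀ x ∈ LinearMap.ker r', IwasawaAlgebra.invol p (ψ z) • x = 0 := by
      intro x hx
      rw [hker_r', LinearMap.mem_range] at hx
      obtain ⟨f, rfl⟩ := hx
      have h0 : Φ' (IwasawaAlgebra.invol p (ψ z)) = 0 := by
        rw [← LinearMap.mem_ker, hΦ'ker]
        exact Ideal.mem_map_of_mem _ haI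
      rw [← map_smul, smul_eq_mul, mul_comm, ← smul_eq_mul, map_smul, h0, smul_zero]
    have hYtors : ∀ x ∈ LinearMap.ker r, IwasawaAlgebra.invol p (ψ z) • x = 0 := by
      intro x hx
      rw [hker_r, LinearMap.mem_range] at hx
      obtain ⟨f, rfl⟩ := hx
      have h0 : Φ (IwasawaAlgebra.invol p (ψ z)) = 0 := by
        rw [← LinearMap.mem_ker, hΦker]
        exact Ideal.mem_map_of_mem _ haI'
      rw [← map_smul, smul_eq_mul, mul_comm, ← smul_eq_mul, map_smul, h0, smul_zero]
    -- §5: the abstract chain (6.15)–(6.16) (`Module.isTorsion_and_charIdeal_eq_of_surjective_pair`)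
    obtain ⟨htors_rs, htors_es, hrank_re, h616⟩ :=
      Module.isTorsion_and_charIdeal_eq_of_surjective_pair r' hr'_surj r hr_surj
        (IwasawaAlgebra.invol p (ψ z)) hιa hY'tors hYtors hX.2 h.lemma67.1 h.lemma67.2
    -- the kernels: `char(ker r') = ι(char(Λ/I))` and `char(ker r') ⊆ char(ker r)` (`I ⊆ I'`)
    have eY' : LinearMap.ker r' ≃ₗ[IwasawaAlgebra p]
        (IwasawaAlgebra p ⧸ Ideal.map (IwasawaAlgebra.invol p) (LinearMap.range ψ)) :=
      (LinearEquiv.ofEq _ _ hker_r').trans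
        (Φ'.quotKerEquivRange.symm.trans (Submodule.quotEquivOfEq _ _ hΦ'ker))
    have eY : LinearMap.ker r ≃ₗ[IwasawaAlgebra p]
        (IwasawaAlgebra p ⧸ Ideal.map (IwasawaAlgebra.invol p) (LinearMap.range ψ')) :=
      (LinearEquiv.ofEq _ _ hker_r).trans
        (Φ.quotKerEquivRange.symm.trans (Submodule.quotEquivOfEq _ _ hΦker))
    have hY'char : Module.charIdeal (IwasawaAlgebra p) (LinearMap.ker r') =
        (Module.charIdeal (IwasawaAlgebra p) (IwasawaAlgebra p ⧸ LinearMap.range ψ)).map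
          (IwasawaAlgebra.invol p) := by
      rw [Module.charIdeal_eq_of_linearEquiv eY', charIdeal_quotient_map_invol]
    have hYchar : Module.charIdeal (IwasawaAlgebra p) (LinearMap.ker r') ≤
        Module.charIdeal (IwasawaAlgebra p) (LinearMap.ker r) := by
      rw [Module.charIdeal_eq_of_linearEquiv eY', Module.charIdeal_eq_of_linearEquiv eY]
      exact Module.charIdeal_quotient_mono _ _ (Ideal.map_mono hII')
        (isTorsion_quotient_map_invol p ha haI)
    -- §6: `(ι a)² ∈ char(X^{rel,str})`
    have hιa_span : Ideal.span {IwasawaAlgebra.invol p (ψ z) ^ 2} =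
        ((Module.charIdeal (IwasawaAlgebra p)
            (selmerLambdaAdic W p κ γ (fun _ ↦ .sgn ε) ⧸ Submodule.span (IwasawaAlgebra p) {z})).map
            (IwasawaAlgebra.invol p)) ^ 2 *
          (Module.charIdeal (IwasawaAlgebra p) (LinearMap.ker r')) ^ 2 := by
      rw [hY'char, ← mul_pow, ← map_invol_mul, h614, map_invol_span_singleton, Ideal.span_singleton_pow]
    have hsq : Ideal.span {IwasawaAlgebra.invol p (ψ z) ^ 2} ≤
        Module.charIdeal (IwasawaAlgebra p) (X W p κ ∅ (PCond.at 𝔭' .str .rel)) := by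
      rw [hιa_span, h616]
      calc ((Module.charIdeal (IwasawaAlgebra p)
              (selmerLambdaAdic W p κ γ (fun _ ↦ .sgn ε) ⧸ Submodule.span (IwasawaAlgebra p) {z})).map
              (IwasawaAlgebra.invol p)) ^ 2 *
            (Module.charIdeal (IwasawaAlgebra p) (LinearMap.ker r')) ^ 2
          ≤ X.torsionCharIdeal W p κ ∅ (fun _ ↦ .sgn ε) hγ *
            (Module.charIdeal (IwasawaAlgebra p) (LinearMap.ker r) *
              Module.charIdeal (IwasawaAlgebra p) (LinearMap.ker r')) := by
            rw [pow_two (Module.charIdeal (IwasawaAlgebra p) (LinearMap.ker r'))]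
            exact Ideal.mul_mono hHoward (Ideal.mul_mono_left hYchar)
        _ = Module.charIdeal (IwasawaAlgebra p) (LinearMap.ker r) *
            (Module.charIdeal (IwasawaAlgebra p) (LinearMap.ker r') *
              Module.charIdeal (IwasawaAlgebra p)
                (Submodule.torsion (IwasawaAlgebra p) (X W p κ ∅ (fun _ ↦ .sgn ε)))) := by
            change Module.charIdeal (IwasawaAlgebra p)
                (Submodule.torsion (IwasawaAlgebra p) (X W p κ ∅ (fun _ ↦ .sgn ε))) * _ = _
            ring
    refine ⟨⟨inferInstance, htors_rs⟩, htors_es, ⟨inferInstance, hrank_re⟩, ?_⟩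
    have hmem := hsq (Ideal.mem_span_singleton_self _)
    rw [hψ] at hmem
    exact hmem
  obtain ⟨Log₀, hLog₀, -⟩ := h.signedLog_erl
  obtain ⟨h1, h2, h3, -⟩ := main Log₀ hLog₀
  exact ⟨h1, h2, h3, fun Log hLog ↦ (main Log hLog).2.2.2⟩

/-- **`L ∈ char_Λ(X^{rel,str}) · R₀⟦T⟧`** — the conclusion of the crux's `⊇` half in the series'
currency: from `TransferInputs … ε z L` and the Howard side, along every structure map
`j : ℤ_p → R₀` compatible with `ℤ_p ⊂ ℂ_p`, `L ∈ (X.charIdeal … (PCond.at 𝔭' .str .rel) hγ).map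
(PowerSeries.map j)` (the explicit reciprocity law `(L) = ι((Log loc_𝔭 z)²) R₀⟦T⟧`, field
`signedLog_erl`, combined with `(ι(Log loc_𝔭 z))² ∈ char_Λ(X^{rel,str})`). Printed: "(ii) … the
following divisibility holds in `Λ^ur`: `char_{Λac}(X^{rel,str}) Λ^ur ⊂ (L_p^BDP)`. The same result
holds for the opposite divisibilities". [cite: CastellaWan2023, Thm. 6.8 (MS p. 30) and its proof (MS pp. 30–31)] -/
theorem TransferInputs.mem_charIdeal_map_of_howard [W.IsElliptic]
    (h : TransferInputs W p κ γ hγ 𝔭 h𝔭 γ𝔭 hγ𝔭 𝔭' h𝔭𝔭' h𝔭p ε z L)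
    (hS : selmerLambdaAdic.HasRank W p κ γ hγ (fun _ ↦ .sgn ε) 1)
    (hX : X.HasRank W p κ ∅ (fun _ ↦ .sgn ε) hγ 1)
    (hHoward :
      letI := selmerLambdaAdic.moduleOfGen W p κ γ hγ (fun _ ↦ PCond.sgn ε)
      ((Module.charIdeal (IwasawaAlgebra p)
          (selmerLambdaAdic W p κ γ (fun _ ↦ .sgn ε) ⧸
            Submodule.span (IwasawaAlgebra p) {z})).map (IwasawaAlgebra.invol p)) ^ 2 ≤
        X.torsionCharIdeal W p κ ∅ (fun _ ↦ .sgn ε) hγ)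
    (j : ℤ_[p] →+* unrIntegers p)
    (hj : ∀ x : ℤ_[p], ((j x : unrIntegers p) : ℂ_[p]) = algebraMap ℚ_[p] ℂ_[p] (x : ℚ_[p])) :
    L ∈ (X.charIdeal W p κ ∅ (PCond.at 𝔭' .str .rel) hγ).map (PowerSeries.map j) := by
  obtain ⟨Log, hLog, herl⟩ := h.signedLog_erl
  have hsq := (h.isFGTorsion_and_sq_mem_charIdeal hS hX hHoward).2.2.2 Log hLog
  have hsq' : IwasawaAlgebra.invol p
      (Log (locSignedAt W p κ 𝔭 h𝔭 γ γ𝔭 hγ𝔭 (fun _ ↦ .sgn ε) ε rfl h𝔭p z) ^ 2) ∈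
        X.charIdeal W p κ ∅ (PCond.at 𝔭' .str .rel) hγ := by
    rw [map_pow]
    exact hsq
  have hle : Ideal.span {L} ≤ (X.charIdeal W p κ ∅ (PCond.at 𝔭' .str .rel) hγ).map (PowerSeries.map j) := by
    rw [herl j hj]
    exact Ideal.map_mono ((Ideal.span_singleton_le_iff_mem _).2 hsq')
  exact (Ideal.span_singleton_le_iff_mem _).1 hle

end Assembly

/-! ## §7 The bridge `X^{rel at 𝔮', str at 𝔮} = X_ac(E[p^∞])` (Castella 2018, Def. 2.2) -/

section Bridge

variable {K : Type u} [Field K] [NumberField K] (W : WeierstrassCurve K) (p : ℕ) [Fact p.Prime]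
  (κ : ZpExtension K p) (S₀ : Set (HeightOneSpectrum (𝓞 K))) {𝔮 : HeightOneSpectrum (𝓞 K)}
  (γ : absoluteGaloisGroup K) [hγF : Fact (κ.IsTopGenerator γ)]

/-- **`X^{str at 𝔮, rel elsewhere} ≃ₗ X_ac^Σ(E[p^∞])` (existence of a `Λ`-linear equivalence)**: the
two duals are `Hom(Sel, ℚ/ℤ)` of the SAME subgroup of `H¹(K_∞, E[p^∞])` (`selmer_at_str_rel_eq_selmerAc`)
with the same action `T = conj_γ − 1` on both sides (`IwasawaDual.IsLocNil.module_smul_comp_eq` for the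
identity-on-classes map). [cite: Castella2018, Def. 2.2 (arXiv:1704.06608 p. 5)]
[cite: CastellaWan2023, Def. 5.1 (MS p. 23)] -/
theorem X.exists_linearEquiv_XAc (h𝔮 : ((p : ℕ) : 𝓞 K) ∈ 𝔮.asIdeal) :
    letI := X.moduleOfGen W p κ S₀ (PCond.at 𝔮 .str .rel) hγF.out
    ∃ e : X W p κ S₀ (PCond.at 𝔮 .str .rel) ≃ₗ[IwasawaAlgebra p] Castella2018.AcSelmer.XAc W p κ 𝔮 S₀ γ,
      ∀ x s, e x s = x ⟨s.1, (selmer_at_str_rel_eq_selmerAc (W := W) (p := p) (κ := κ) S₀ h𝔮).ge s.2⟩ := by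
  letI iX : Module (IwasawaAlgebra p) (X W p κ S₀ (PCond.at 𝔮 .str .rel)) :=
    X.moduleOfGen W p κ S₀ (PCond.at 𝔮 .str .rel) hγF.out
  have heq := selmer_at_str_rel_eq_selmerAc (W := W) (p := p) (κ := κ) S₀ h𝔮
  -- the two inclusions (identity on classes)
  let j₁ : Castella2018.AcSelmer.selmerAc W p κ 𝔮 S₀ →+ selmer W p κ S₀ (PCond.at 𝔮 .str .rel) :=
    AddSubgroup.inclusion heq.ge
  let j₂ : selmer W p κ S₀ (PCond.at 𝔮 .str .rel) →+ Castella2018.AcSelmer.selmerAc W p κ 𝔮 S₀ :=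
    AddSubgroup.inclusion heq.le
  have hj₁₂ : ∀ s, j₁ (j₂ s) = s := fun s ↦ Subtype.ext rfl
  have hj₂₁ : ∀ s, j₂ (j₁ s) = s := fun s ↦ Subtype.ext rfl
  have hj₁ψ : ∀ s, j₁ ((Castella2018.AcSelmer.conjSelmerAc W p κ 𝔮 S₀ γ - 1) s) =
      (conjSelmer W p κ S₀ (PCond.at 𝔮 .str .rel) γ - 1) (j₁ s) := fun s ↦ by
    apply Subtype.ext
    simp only [j₁, IwasawaDual.End_sub_apply, AddMonoid.End.one_apply, map_sub,
      AddSubgroup.coe_inclusion, AddSubgroupClass.coe_sub, coe_conjSelmer_apply,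
      Castella2018.AcSelmer.coe_conjSelmerAc_apply]
  let e : X W p κ S₀ (PCond.at 𝔮 .str .rel) ≃ₗ[IwasawaAlgebra p] Castella2018.AcSelmer.XAc W p κ 𝔮 S₀ γ :=
    { toFun := fun x ↦ x.comp j₁
      invFun := fun y ↦ y.comp j₂
      map_add' := fun x y ↦ AddMonoidHom.ext fun s ↦ rfl
      map_smul' := fun f x ↦ by
        change ((isLocNil_conjSelmer_sub_one W p κ S₀ (PCond.at 𝔮 .str .rel) hγF.out).smulFun f x).comp
            j₁ =
          (Castella2018.AcSelmer.isLocNil_conjSelmerAc_sub_one W p κ 𝔮 S₀ hγF.out).smulFun f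
            (x.comp j₁)
        exact (IwasawaDual.IsLocNil.smulFun_comp_eq
          (Castella2018.AcSelmer.isLocNil_conjSelmerAc_sub_one W p κ 𝔮 S₀ hγF.out)
          (isLocNil_conjSelmer_sub_one W p κ S₀ (PCond.at 𝔮 .str .rel) hγF.out) j₁ hj₁ψ f x).symm
      left_inv := fun x ↦ AddMonoidHom.ext fun s ↦ by change x (j₁ (j₂ s)) = x s; rw [hj₁₂]
      right_inv := fun y ↦ AddMonoidHom.ext fun s ↦ by change y (j₂ (j₁ s)) = y s; rw [hj₂₁] }
  exact ⟨e, fun x s ↦ rfl⟩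

/-- **`char_Λ(X^{str at 𝔮, rel elsewhere}) = Ch_Λ(X_ac^Σ(E[p^∞]))`** (`AcSelmer.XAc.charIdeal`, the
object in which the tree states the BDP-type main conjectures and the crux
`TwinSplitIMCAtThreeGoodSSApZero`). [cite: Castella2018, Def. 2.2 and Thm. 2.3 (arXiv:1704.06608 p. 5)]
[cite: CastellaWan2023, Def. 5.1 and Conj. 5.2 (MS p. 23)] -/
theorem X.charIdeal_at_str_rel_eq_XAc_charIdeal (h𝔮 : ((p : ℕ) : 𝓞 K) ∈ 𝔮.asIdeal) :
    X.charIdeal W p κ S₀ (PCond.at 𝔮 .str .rel) hγF.out =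
      Castella2018.AcSelmer.XAc.charIdeal W p κ 𝔮 S₀ γ := by
  letI iX : Module (IwasawaAlgebra p) (X W p κ S₀ (PCond.at 𝔮 .str .rel)) :=
    X.moduleOfGen W p κ S₀ (PCond.at 𝔮 .str .rel) hγF.out
  obtain ⟨e, -⟩ := X.exists_linearEquiv_XAc W p κ S₀ γ h𝔮
  exact Module.charIdeal_eq_of_linearEquiv e

/-- Torsion transports: `X^{str at 𝔮, rel elsewhere}` torsion ⟹ `X_ac^Σ(E[p^∞])` torsion.
[cite: Castella2018, Thm. 2.3 (arXiv:1704.06608 p. 5)] -/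
theorem X.isTorsion_XAc_of_at_str_rel (h𝔮 : ((p : ℕ) : 𝓞 K) ∈ 𝔮.asIdeal)
    (hT : letI := X.moduleOfGen W p κ S₀ (PCond.at 𝔮 .str .rel) hγF.out
      Module.IsTorsion (IwasawaAlgebra p) (X W p κ S₀ (PCond.at 𝔮 .str .rel))) :
    Module.IsTorsion (IwasawaAlgebra p) (Castella2018.AcSelmer.XAc W p κ 𝔮 S₀ γ) := by
  letI iX : Module (IwasawaAlgebra p) (X W p κ S₀ (PCond.at 𝔮 .str .rel)) :=
    X.moduleOfGen W p κ S₀ (PCond.at 𝔮 .str .rel) hγF.out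
  obtain ⟨e, -⟩ := X.exists_linearEquiv_XAc W p κ S₀ γ h𝔮
  intro y
  obtain ⟨c, hc⟩ := @hT (e.symm y)
  refine ⟨c, ?_⟩
  rw [Submonoid.smul_def, ← e.symm.map_eq_zero_iff, map_smul, ← Submonoid.smul_def]
  exact hc

end Bridge

/-! ## §8 The crux-shaped corollary for a base change `W⁄K` -/

section Corollary

variable {K : Type} [Field K] [NumberField K] {W : WeierstrassCurve ℚ} {p : ℕ} [Fact p.Prime]
  {κ : ZpExtension K p} {γ : absoluteGaloisGroup K} [hγF : Fact (κ.IsTopGenerator γ)]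
  {𝔭 : HeightOneSpectrum (𝓞 K)} {h𝔭 : IsNonsplitIn κ 𝔭} {γ𝔭 : absoluteGaloisGroup (𝔭.adicCompletion K)}
  {hγ𝔭 : κ (resGalOfEmb (closureEmb (K := K) (𝔭.adicCompletion K)) γ𝔭) = κ γ}
  {𝔭' : HeightOneSpectrum (𝓞 K)} {h𝔭𝔭' : 𝔭 ≠ 𝔭'} {h𝔭p : ((p : ℕ) : 𝓞 K) ∈ 𝔭.asIdeal} {ε : ℤˣ}
  {z : selmerLambdaAdic (W.baseChange K) p κ γ (fun _ ↦ .sgn ε)} {L : UnrSeries p}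

/-- **The `⊇` half of the BDP main conjecture from the transfer inputs and the Howard side, in the
crux's object `AcSelmer.XAc`.** For `E/ℚ` elliptic with model `W`, base-changed to `K`, `p ∈ 𝔭'`:
`TransferInputs (W⁄K) p κ γ … ε z L` + (`Sel_ε` rank one, `X_ε` rank one, `ι(char(Sel_ε/Λz))² ⊆
char_t(X_ε)` — in the sibling currency `X.torsionCharIdeal … ≥ (signedHeegnerCharIdeal hγ ε z).map ι ^ 2`)
⟹ `X_ac(E[p^∞])` (strict at `𝔭'`) is `Λ`-torsion and, along every compatible `j : ℤ_p → R₀`,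
`L ∈ Ch_Λ(X_ac) · R₀⟦T⟧`. At `p = 3` this is the statement of the crux's `stub_howardFrameSS_apZero`
modulo its inputs; nothing is established at `p = 3` by this file.
[cite: CastellaWan2023, Thm. 6.8 and Thm. A.5 (MS pp. 30, 35–36)] [cite: Castella2018, Def. 2.2] -/
theorem TransferInputs.mem_XAc_charIdeal_map_of_howard [W.IsElliptic]
    (h : TransferInputs (W.baseChange K) p κ γ hγF.out 𝔭 h𝔭 γ𝔭 hγ𝔭 𝔭' h𝔭𝔭' h𝔭p ε z L)
    (h𝔭'p : ((p : ℕ) : 𝓞 K) ∈ 𝔭'.asIdeal)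
    (hS : selmerLambdaAdic.HasRank (W.baseChange K) p κ γ hγF.out (fun _ ↦ .sgn ε) 1)
    (hX : X.HasRank (W.baseChange K) p κ ∅ (fun _ ↦ .sgn ε) hγF.out 1)
    (hHoward : (signedHeegnerCharIdeal hγF.out ε z).map (IwasawaAlgebra.invol p) ^ 2 ≤
        X.torsionCharIdeal (W.baseChange K) p κ ∅ (fun _ ↦ .sgn ε) hγF.out)
    (j : ℤ_[p] →+* unrIntegers p)
    (hj : ∀ x : ℤ_[p], ((j x : unrIntegers p) : ℂ_[p]) = algebraMap ℚ_[p] ℂ_[p] (x : ℚ_[p])) :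
    Module.IsTorsion (IwasawaAlgebra p) (Castella2018.AcSelmer.XAc (W.baseChange K) p κ 𝔭' ∅ γ) ∧
    L ∈ (Castella2018.AcSelmer.XAc.charIdeal (W.baseChange K) p κ 𝔭' ∅ γ).map (PowerSeries.map j) := by
  have hmain := h.isFGTorsion_and_sq_mem_charIdeal hS hX hHoward
  refine ⟨X.isTorsion_XAc_of_at_str_rel (W.baseChange K) p κ ∅ γ h𝔭'p hmain.1.2, ?_⟩
  rw [← X.charIdeal_at_str_rel_eq_XAc_charIdeal (W.baseChange K) p κ ∅ γ h𝔭'p]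
  exact h.mem_charIdeal_map_of_howard hS hX hHoward j hj

end Corollary

end Literature.NumberTheory.EllipticCurves.AcSigned

end
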